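import Literature.AlgebraicGeometry.Motives.SeesawRelativeChartSections
import Literature.AlgebraicGeometry.Motives.SeesawChartKernelReprChart
import Literature.AlgebraicGeometry.Modules.RelativeAffineTestObjects
import HarnessLib

/-!
# RELATIVE EDITION (ring base `R`) — The (1b) adapter, chart layer: test objects `Spec B → Spec A → U ⊆ W`, ring identifications
# `εB : B ≅ Γ(Spec B, 𝒪)`, finite affine Čech covers of `X × Spec A`

RELATIVE EDITION of ★ `Motives/SeesawChartKernelReprChart` (cell `hodgecm-mathlib`, F-DAG hand (h8-E) «engine of the relative seesaw»,
file E8; author B-p08 (g12); port map `B-provers/B-p08/g11/PORTMAP-h8-RelativeSeesaw.B-p08g11.md`): the ★ file is typed over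
`SchemeOver ℂ` / `{K : Type} [Field K]`; its only FIELD-SPECIFIC content — ★ `flat_hom_of_field` and ★ `universallyOpen_hom_of_isProper` —
is NOT ported: over a ring base flatness and universal openness of `X → Spec R` are the explicit binders `[Flat X.hom] [UniversallyOpen X.hom]`
of the engine (as in ★ `Modules/*`); the noetherianity of the chart ring is taken from `[IsLocallyNoetherian W.left]` (★: from
`LocallyOfFiniteType W.hom` over `ℂ`).  The base-free ★ helpers (`SecMod.val_fun_eq` / `mk_fun_eq`, `isAffineOpen_finset_inf'`,
`exists_finite_affine_cover'`, `toSections_top_apply`, §B4 `secModOfIso*`, `SecMod.val_smul_top`) are IMPORTED from ★, not copied.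
Everything else is re-declared decl for decl with `ℂ ↦ R` against g11՚s ★ relative chart vocabulary `SeesawRelative.specTest / FB / H0 /
toTopRing` (`Motives/SeesawRelativeChartSections`) and the relative test objects `Modules.Relative.*` (`Modules/RelativeAffineTestObjects`):
unapplied forms `Modules.Relative.pullSec_def` / `testAlgHom_apply`; `SeesawRelative.isSeparated_tensor_left`, `exists_affine_cechCover`;
§B2 `εR`, `εR_apply`, `toTopRing_eq_baseToTotal`, `jTest`, `εR_algebraMap`, `specTestMap_comp_jTest`, `specTestMap_comp_ofId`,
`whiskerLeft_specTestMap_comp_ofId`, `whiskerLeft_ofId_comp_specTestHom`, `whiskerLeft_specTestMap_comp_specTestHom`, `εR_natural`; §B3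
`isNoetherianRing_chart`, `isNoetherianRing_ΓSpec_chart`, `isLocallyNoetherian_specTest_chart`.  Everything is proved; no named facts, no
`sorry`.  HC_CM is proved only modulo the 7 printed citations until rung 0 closes; this file asserts nothing about HC.  Original module
docstring:

Chart-level plumbing of the kernel representation `H0KernelRepr` ([MumfordAV1970] §5, Lemmas 1–2 and Cor. 2, pp. 46–50:
«the Grothendieck complex represents `B ↦ H⁰(X_B, L_B)` on `A`-algebras»; [GortzWedhorn2023] Cor. 23.135) for the seesaw
chart `U ⊆ W`, `A = Γ(W, U)` (★ `Motives.SeesawChartSections`: `specTest`, `FB`, `H0`, `H0map`, `toTopRing`) against the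
affine test objects of ★ `Modules.AffineTestObjects` (`testMap`, `testMod`, `testRingHom`, `testModCompIso`, `pullSec`,
`testAlgHom`; `SecMod`, `baseToTotal`).

## References
* [MumfordAV1970] D. Mumford, *Abelian Varieties*, TIFR Studies in Mathematics 5 (1970), §5, Lemmas 1–2, Cor. 2 (pp. 46–50).
* [GortzWedhorn2023] U. Görtz, T. Wedhorn, *Algebraic Geometry II: Cohomology of Schemes* (2023), Cor. 23.135 (p. 355), (23.28.5).
-/

set_option autoImplicit false

noncomputable section

set_option backward.isDefEq.respectTransparency false

universe u

open CategoryTheory CategoryTheory.Limits AlgebraicGeometry MonoidalCategory CartesianMonoidalCategory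
  Opposite TopologicalSpace
open scoped TensorProduct

namespace Literature.AlgebraicGeometry.Modules

open Literature.AlgebraicGeometry.Motives

/-! ### Unapplied forms of `Relative.pullSec` / `Relative.testAlgHom` (★ `Modules.RelativeAffineTestObjects`; `SecMod.val_fun_eq` / `mk_fun_eq` are ★ `Motives/SeesawChartKernelReprChart`) -/

namespace Relative

section UnappliedForms

variable {R : Type u} [CommRing R] (P T : SchemeOver R) [IsAffine T.left]
variable (L : (P ⊗ T).left.Modules)
variable {T' T'' : SchemeOver R} [IsAffine T'.left] [IsAffine T''.left] (j' : T' ⟶ T) (j'' : T'' ⟶ T)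
  (k : T'' ⟶ T') (hk : k ≫ j' = j'')

omit [IsAffine T.left] [IsAffine T'.left] [IsAffine T''.left] in
/-- B-p10's `pullSec` unfolded (unapplied form). [cite: GortzWedhorn2023, Cor. 23.135 (p. 355)] -/
theorem pullSec_def : Relative.pullSec P T L j' j'' k hk = fun x =>
    SecMod.mk (((Relative.testModCompIso P T L j' j'' k hk).hom.app ⊤)
      (unitSectionLE (Relative.testMap P T' k) (Relative.testMod P T j' L) (V := ⊤) (U := ⊤) le_top (SecMod.val x))) := rfl

omit [IsAffine T.left] [IsAffine T'.left] [IsAffine T''.left] in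
/-- B-p10's `testAlgHom` is `testRingHom T' k` as a function. [cite: GortzWedhorn2023, Cor. 23.135 (p. 355)] -/
theorem testAlgHom_apply (x : Γ(T'.left, (⊤ : T'.left.Opens))) :
    letI := Relative.testAlgebra T j'; letI := Relative.testAlgebra T j''
    Relative.testAlgHom T j' j'' k hk x = Relative.testRingHom T' k x := rfl

end UnappliedForms

end Relative

end Literature.AlgebraicGeometry.Modules

namespace Literature.AlgebraicGeometry.Motives

namespace SeesawRelative

open Literature.AlgebraicGeometry.Modules

/-! ### §B1 Separatedness and affine Čech covers of `P ×_R T` (flatness / universal openness are BINDERS over a ring base) -/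

section Instances

variable {R : Type} [CommRing R]

/-- `P ×_R T` is a separated scheme for `P → Spec K` separated and `T` affine. [cite: MumfordAV1970, §5 (pp. 46–47)] -/
theorem isSeparated_tensor_left (P T : SchemeOver R) [IsSeparated P.hom] [IsAffine T.left] :
    (P ⊗ T).left.IsSeparated := by
  haveI : IsSeparated (snd P T).left := inferInstanceAs (IsSeparated (pullback.snd P.hom T.hom))
  constructor
  rw [show terminal.from (P ⊗ T).left = (snd P T).left ≫ terminal.from T.left from terminal.hom_ext _ _]
  infer_instance

/-- **A finite affine open cover with affine finite intersections** of `P ×_R T` (`P` proper — hence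
quasi-compact and separated — over `K`, `T` affine), indexed by `Fin n`. [cite: MumfordAV1970, §5 (pp. 46–47)] -/
theorem exists_affine_cechCover (P T : SchemeOver R) [IsProper P.hom] [IsAffine T.left] :
    ∃ (n : ℕ) (𝓥 : Fin n → (P ⊗ T).left.Opens),
      (∀ s : Finset (Fin n), s.Nonempty → IsAffineOpen (cechOpen 𝓥 s)) ∧ ⨆ i, 𝓥 i = ⊤ := by
  haveI : (P ⊗ T).left.IsSeparated := SeesawRelative.isSeparated_tensor_left P T
  haveI : QuasiCompact (snd P T).left := inferInstanceAs (QuasiCompact (pullback.snd P.hom T.hom))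
  haveI : CompactSpace (P ⊗ T).left := QuasiCompact.compactSpace_of_compactSpace (snd P T).left
  obtain ⟨n, V, hV⟩ := SeesawSubscheme.exists_finite_affine_cover' (P ⊗ T).left
  exact ⟨n, fun i => (V i : (P ⊗ T).left.Opens),
    fun s hs => SeesawSubscheme.isAffineOpen_finset_inf' s hs _ fun i _ => (V i).2, hV⟩

end Instances
/-! ### §B2 The chart test objects: `T = Spec A → U ⊆ W`, `L = 𝓕_A`, ring identifications -/

section Chart

variable {R : Type} [CommRing R] (X : SchemeOver R) {W : SchemeOver R} (𝓕 : (X ⊗ W).left.Modules) (U : W.left.affineOpens)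

/-- `εB : B ≅ Γ(Spec B, 𝒪)`, the inverse of Mathlib's `ΓSpecIso`, as a ring isomorphism (non-Prop plumbing).
[cite: MumfordAV1970, §5 (pp. 46–47)] -/
def εR (B : Type) [CommRing B] [Algebra Γ(W.left, U) B] :
    B ≃+* Γ((SeesawRelative.specTest U B).left, (⊤ : (SeesawRelative.specTest U B).left.Opens)) :=
  (Scheme.ΓSpecIso (.of B)).commRingCatIsoToRingEquiv.symm

/-- `εR` is `(ΓSpecIso B)⁻¹` as a function (unapplied form). [cite: MumfordAV1970, §5 (pp. 46–47)] -/
theorem εR_apply (B : Type) [CommRing B] [Algebra Γ(W.left, U) B] (b : B) :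
    SeesawRelative.εR U B b = (Scheme.ΓSpecIso (.of B)).inv b := rfl

/-- `toTopRing = Relative.baseToTotal ∘ εB`. [cite: MumfordAV1970, §5 (pp. 46–47)] -/
theorem toTopRing_eq_baseToTotal (B : Type) [CommRing B] [Algebra Γ(W.left, U) B] (b : B) :
    toTopRing X U B b = Relative.baseToTotal X (specTest U B) (SeesawRelative.εR U B b) := rfl

/-- The chart morphism `Spec B → Spec A` over `W` for an `A`-algebra `B`, `A = Γ(W, U)` (non-Prop plumbing).
[cite: MumfordAV1970, §5 (pp. 46–47)] -/
abbrev jTest (B : Type) [CommRing B] [Algebra Γ(W.left, U) B] :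
    SeesawRelative.specTest U B ⟶ SeesawRelative.specTest U Γ(W.left, U) :=
  specTestMap U (Algebra.ofId Γ(W.left, U) B)

/-- **`εB ∘ algebraMap = j♯ ∘ εA`** (naturality of `ΓSpecIso`): the ring identifications intertwine the algebra
structure of `B` and B-p10's `testAlgebra` structure of `Γ(Spec B, 𝒪)` over `Γ(Spec A, 𝒪)`. [cite: MumfordAV1970, §5 (pp. 46–47)] -/
theorem εR_algebraMap (B : Type) [CommRing B] [Algebra Γ(W.left, U) B] (a : Γ(W.left, U)) :
    SeesawRelative.εR U B (algebraMap Γ(W.left, U) B a) =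
      Modules.Relative.testRingHom (specTest U Γ(W.left, U)) (SeesawRelative.jTest U B) (SeesawRelative.εR U Γ(W.left, U) a) := by
  have h := congrArg (fun f => f.hom a)
    (Scheme.ΓSpecIso_inv_naturality (CommRingCat.ofHom (algebraMap Γ(W.left, U) B)))
  simp only [CommRingCat.hom_comp, RingHom.comp_apply, CommRingCat.hom_ofHom] at h
  rw [SeesawRelative.εR_apply, SeesawRelative.εR_apply, h]
  have e2 : (SeesawRelative.jTest U B).left.appLE ⊤ ⊤ le_top = (SeesawRelative.jTest U B).left.app ⊤ := (Scheme.Hom.app_eq_appLE _).symm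
  change _ = ((SeesawRelative.jTest U B).left.appLE ⊤ ⊤ le_top).hom _
  rw [e2]
  rfl

/-- **`Spec φ ≫ (Spec B → Spec A) = (Spec C → Spec A)`** over `W` for an `A`-algebra map `φ : B → C`. [cite: MumfordAV1970, §5 (pp. 46–47)] -/
theorem specTestMap_comp_jTest {B C : Type} [CommRing B] [Algebra Γ(W.left, U) B] [CommRing C]
    [Algebra Γ(W.left, U) C] (φ : B →ₐ[Γ(W.left, U)] C) : specTestMap U φ ≫ SeesawRelative.jTest U B = SeesawRelative.jTest U C := by
  ext : 1
  change Spec.map _ ≫ Spec.map _ = Spec.map _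
  rw [← Spec.map_comp, ← CommRingCat.ofHom_comp]
  congr 2
  ext b
  exact (φ.commutes b)

/-- `Spec φ ≫ Spec(ofId B) = Spec(ofId C)` over `W` (B-p01's `FBIso` spelling of `specTestMap_comp_jTest`). [cite: MumfordAV1970, §5 (pp. 46–47)] -/
theorem specTestMap_comp_ofId {B C : Type} [CommRing B] [Algebra Γ(W.left, U) B] [CommRing C]
    [Algebra Γ(W.left, U) C] (φ : B →ₐ[Γ(W.left, U)] C) :
    SeesawRelative.specTestMap U φ ≫ SeesawRelative.specTestMap U (Algebra.ofId Γ(W.left, U) B) =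
      SeesawRelative.specTestMap U (Algebra.ofId Γ(W.left, U) C) := by
  ext : 1
  change Spec.map _ ≫ Spec.map _ = Spec.map _
  rw [← Spec.map_comp, ← CommRingCat.ofHom_comp]
  congr 2
  ext b
  exact (φ.commutes b)

/-- `(1 × Spec φ) ≫ (1 × Spec(ofId B)) = 1 × Spec(ofId C)` on total spaces. [cite: MumfordAV1970, §5 (pp. 46–47)] -/
theorem whiskerLeft_specTestMap_comp_ofId (X : SchemeOver R) {B C : Type} [CommRing B] [Algebra Γ(W.left, U) B]
    [CommRing C] [Algebra Γ(W.left, U) C] (φ : B →ₐ[Γ(W.left, U)] C) :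
    (X ◁ specTestMap U φ).left ≫ (X ◁ specTestMap U (Algebra.ofId Γ(W.left, U) B)).left =
      (X ◁ specTestMap U (Algebra.ofId Γ(W.left, U) C)).left := by
  rw [← Over.comp_left, ← MonoidalCategory.whiskerLeft_comp, SeesawRelative.specTestMap_comp_ofId]

/-- `(1 × Spec(ofId B)) ≫ (1 × u_A) = 1 × u_B` on total spaces. [cite: MumfordAV1970, §5 (pp. 46–47)] -/
theorem whiskerLeft_ofId_comp_specTestHom (X : SchemeOver R) (B : Type) [CommRing B] [Algebra Γ(W.left, U) B] :
    (X ◁ specTestMap U (Algebra.ofId Γ(W.left, U) B)).left ≫ (X ◁ specTestHom U Γ(W.left, U)).left =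
      (X ◁ specTestHom U B).left := by
  rw [← Over.comp_left, ← MonoidalCategory.whiskerLeft_comp, specTestMap_comp]

/-- `(1 × Spec φ) ≫ (1 × u_B) = 1 × u_C` on total spaces (the equation inside B-p01's `FBIso`). [cite: MumfordAV1970, §5 (pp. 46–47)] -/
theorem whiskerLeft_specTestMap_comp_specTestHom (X : SchemeOver R) {B C : Type} [CommRing B]
    [Algebra Γ(W.left, U) B] [CommRing C] [Algebra Γ(W.left, U) C] (φ : B →ₐ[Γ(W.left, U)] C) :
    (X ◁ specTestMap U φ).left ≫ (X ◁ specTestHom U B).left = (X ◁ specTestHom U C).left := by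
  rw [← Over.comp_left, ← MonoidalCategory.whiskerLeft_comp, specTestMap_comp]

/-- **`εC ∘ φ = (Spec φ)♯ ∘ εB`** (naturality of `ΓSpecIso` along `φ`), with `(Spec φ)♯` in B-p10's `testRingHom` form.
[cite: MumfordAV1970, §5 (pp. 46–47)] -/
theorem εR_natural {B C : Type} [CommRing B] [Algebra Γ(W.left, U) B] [CommRing C] [Algebra Γ(W.left, U) C]
    (φ : B →ₐ[Γ(W.left, U)] C) (b : B) :
    SeesawRelative.εR U C (φ b) = Modules.Relative.testRingHom (specTest U B) (specTestMap U φ) (SeesawRelative.εR U B b) := by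
  have h := congrArg (fun f => f.hom b) (Scheme.ΓSpecIso_inv_naturality (CommRingCat.ofHom (φ : B →+* C)))
  simp only [CommRingCat.hom_comp, RingHom.comp_apply, CommRingCat.hom_ofHom] at h
  rw [SeesawRelative.εR_apply, SeesawRelative.εR_apply]
  refine (h : _).trans ?_
  have e2 : (specTestMap U φ).left.appLE ⊤ ⊤ le_top = (specTestMap U φ).left.app ⊤ :=
    (Scheme.Hom.app_eq_appLE _).symm
  change _ = ((specTestMap U φ).left.appLE ⊤ ⊤ le_top).hom _
  rw [e2]
  rfl

end Chart
/-! ### §B3 Noetherianity of the chart ring; local instances for B-p10's Grothendieck complex over the chart -/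

section ChartInstances

variable {R : Type} [CommRing R] (X : SchemeOver R) {W : SchemeOver R} (𝓕 : (X ⊗ W).left.Modules) (U : W.left.affineOpens)

/-- `Γ(U, 𝒪_W)` is noetherian for `W` locally noetherian and `U` affine (relative edition of ★ `SeesawSubscheme.isNoetherianRing_chart`: there `W` is locally of finite type over `ℂ`). [cite: MumfordAV1970, §5 (pp. 46–47)] -/
theorem isNoetherianRing_chart [IsLocallyNoetherian W.left] : IsNoetherianRing Γ(W.left, U) :=
  IsLocallyNoetherian.component_noetherian U

/-- `Γ(Spec A, 𝒪)` is noetherian, `A = Γ(U, 𝒪_W)`. [cite: MumfordAV1970, §5 (pp. 46–47)] -/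
theorem isNoetherianRing_ΓSpec_chart [IsLocallyNoetherian W.left] :
    IsNoetherianRing Γ((specTest U Γ(W.left, U)).left, (⊤ : (specTest U Γ(W.left, U)).left.Opens)) := by
  haveI := SeesawRelative.isNoetherianRing_chart U
  exact isNoetherianRing_of_ringEquiv Γ(W.left, U) (SeesawRelative.εR U Γ(W.left, U))

/-- `Spec A` is locally noetherian, `A = Γ(U, 𝒪_W)`. [cite: MumfordAV1970, §5 (pp. 46–47)] -/
theorem isLocallyNoetherian_specTest_chart [IsLocallyNoetherian W.left] :
    IsLocallyNoetherian (specTest U Γ(W.left, U)).left := by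
  haveI := SeesawRelative.isNoetherianRing_chart U
  exact inferInstanceAs (IsLocallyNoetherian (Spec (.of Γ(W.left, U))))

end ChartInstances

end SeesawRelative

end Literature.AlgebraicGeometry.Motives

end
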